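import Literature.NumberTheory.QuadraticForms.HasseMinkowskiIsometryRat
import Literature.NumberTheory.QuadraticForms.TernaryAnisotropicPlaces
import Mathlib.NumberTheory.Padics.HeightOneSpectrum
import HarnessLib

/-!
# The places of `ℚ`: dictionary between `ℚ_v` / `ℚ_w` and `ℚ_[p]` / `ℝ` for diagonal forms

Topic `NumberTheory/QuadraticForms`; namespace `Literature.NumberTheory.QuadraticForms`. Everything here
is proved. The tree states local conditions on rational quadratic forms in two vocabularies: the
number-field one (completions `v.adicCompletion ℚ` at `v : HeightOneSpectrum (𝓞 ℚ)` and `w.Completion`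
at `w : InfinitePlace ℚ`, as in `hasseMinkowski_numberField`, `hilbertReciprocity`,
`TernaryAnisotropicPlaces.lean`) and Serre's (`ℚ_p` = Mathlib's `ℚ_[p]`, `ℚ_∞ = ℝ`, as in
`HasseMinkowskiExceptOnePlace.lean`, `DiagIsotropicRatCriteria.lean`). Mathlib identifies the two:
`Rat.HeightOneSpectrum.adicCompletion.padicEquiv v : ℚ_v ≃A[ℚ] ℚ_[p]` for `p = primesEquiv v`, and
`InfinitePlace.Completion.ringEquivRealOfIsReal : ℚ_w ≃+* ℝ` (`ℚ` is totally real with one infinite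
place). This file records the resulting dictionary for the tree's diagonal-form notions (isotropy,
isometry, Hilbert symbol, `ε`), and, as an application, the parity theorem of
`TernaryAnisotropicPlaces.lean` in Serre's language: a rational ternary form fails to represent `0` at
finitely many primes, and the number of such primes, plus one if the form is definite, is even (Serre,
Ch. IV §3.2 Cor. 3 / Ch. III §2.1 Thm 3).

## References

* J.-P. Serre, *A Course in Arithmetic*, GTM 7, Springer 1973, Ch. III §2.1 Thm 3, Ch. IV §3.1–§3.2
  [corpus:book:serre1973-course-arithmetic p0042]. [Serre1973]
* O. T. O'Meara, *Introduction to Quadratic Forms*, Grundlehren 117, Springer 1963, §66. [Omeara1963]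
-/

noncomputable section

open NumberField IsDedekindDomain Finset

namespace Literature.NumberTheory.QuadraticForms

/-! ### Finite places -/

section Finite

variable (v : HeightOneSpectrum (𝓞 ℚ))

variable [Fact (Rat.HeightOneSpectrum.primesEquiv (R := 𝓞 ℚ) v : ℕ).Prime]

/-- Mathlib's `ℚ_v ≃ ℚ_[p]` (`adicCompletion.padicEquiv`) sends `algebraMap ℚ ℚ_v q` to `q` (Serre,
Ch. IV §3.1: for `v = p` a prime, `ℚ_v` is the `p`-adic field `ℚ_p`). [cite: Serre1973, Ch. IV §3.1] -/
theorem padicEquiv_algebraMap_rat (q : ℚ) :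
    (Rat.HeightOneSpectrum.adicCompletion.padicEquiv (R := 𝓞 ℚ) v).toAlgEquiv.toRingEquiv
      (algebraMap ℚ (v.adicCompletion ℚ) q) = (q : ℚ_[Rat.HeightOneSpectrum.primesEquiv (R := 𝓞 ℚ) v]) := by
  change (Rat.HeightOneSpectrum.adicCompletion.padicEquiv (R := 𝓞 ℚ) v).toAlgEquiv
    (algebraMap ℚ (v.adicCompletion ℚ) q) = _
  rw [AlgEquiv.commutes, eq_ratCast]

/-- **Isotropy at a finite place of `ℚ`**: `⟨c⟩` represents `0` in `ℚ_v` iff it does in `ℚ_[p]`,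
`p` the prime under `v`. [cite: Omeara1963, §66 Thm 66:1] -/
theorem diagIsotropic_adicCompletion_rat_iff {n : ℕ} (c : Fin n → ℚ) :
    DiagIsotropic (fun i => algebraMap ℚ (v.adicCompletion ℚ) (c i)) ↔
      DiagIsotropic (fun i => (c i : ℚ_[Rat.HeightOneSpectrum.primesEquiv (R := 𝓞 ℚ) v])) := by
  have hfun : (fun i => (Rat.HeightOneSpectrum.adicCompletion.padicEquiv (R := 𝓞 ℚ) v).toAlgEquiv.toRingEquiv
      (algebraMap ℚ (v.adicCompletion ℚ) (c i))) =
      fun i => (c i : ℚ_[Rat.HeightOneSpectrum.primesEquiv (R := 𝓞 ℚ) v]) :=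
    funext fun i => padicEquiv_algebraMap_rat v (c i)
  constructor
  · intro h
    rw [← hfun]
    exact h.map (Rat.HeightOneSpectrum.adicCompletion.padicEquiv (R := 𝓞 ℚ) v).toAlgEquiv.toRingEquiv.toRingHom
      (RingEquiv.injective _)
  · intro h
    refine DiagIsotropic.of_ringEquiv
      (Rat.HeightOneSpectrum.adicCompletion.padicEquiv (R := 𝓞 ℚ) v).toAlgEquiv.toRingEquiv ?_
    rw [hfun]
    exact h

/-- **Isometry at a finite place of `ℚ`**: `⟨a⟩ ≅ ⟨b⟩` over `ℚ_v` iff over `ℚ_[p]`.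
[cite: Omeara1963, §66 Thm 66:4] -/
theorem diagIsometric_adicCompletion_rat_iff {n : ℕ} (a b : Fin n → ℚ) :
    DiagIsometric (fun i => algebraMap ℚ (v.adicCompletion ℚ) (a i))
        (fun i => algebraMap ℚ (v.adicCompletion ℚ) (b i)) ↔
      DiagIsometric (fun i => (a i : ℚ_[Rat.HeightOneSpectrum.primesEquiv (R := 𝓞 ℚ) v]))
        (fun i => (b i : ℚ_[Rat.HeightOneSpectrum.primesEquiv (R := 𝓞 ℚ) v])) := by
  have hfun : ∀ c : Fin n → ℚ,
      (fun i => (Rat.HeightOneSpectrum.adicCompletion.padicEquiv (R := 𝓞 ℚ) v).toAlgEquiv.toRingEquiv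
        (algebraMap ℚ (v.adicCompletion ℚ) (c i))) =
      fun i => (c i : ℚ_[Rat.HeightOneSpectrum.primesEquiv (R := 𝓞 ℚ) v]) :=
    fun c => funext fun i => padicEquiv_algebraMap_rat v (c i)
  constructor
  · intro h
    rw [← hfun a, ← hfun b]
    exact h.map (Rat.HeightOneSpectrum.adicCompletion.padicEquiv (R := 𝓞 ℚ) v).toAlgEquiv.toRingEquiv.toRingHom
  · intro h
    refine DiagIsometric.of_ringEquiv
      (Rat.HeightOneSpectrum.adicCompletion.padicEquiv (R := 𝓞 ℚ) v).toAlgEquiv.toRingEquiv ?_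
    rw [hfun a, hfun b]
    exact h

/-- **The Hilbert symbol at a finite place of `ℚ`** is the Hilbert symbol of `ℚ_[p]`.
[cite: Serre1973, Ch. III §1.2 Thm. 1] -/
theorem hilbertSymbol_adicCompletion_rat_eq (a b : ℚ) :
    hilbertSymbol (v.adicCompletion ℚ) (algebraMap ℚ _ a) (algebraMap ℚ _ b) =
      hilbertSymbol ℚ_[Rat.HeightOneSpectrum.primesEquiv (R := 𝓞 ℚ) v] a b := by
  rw [← hilbertSymbol_map_ringEquiv
      (Rat.HeightOneSpectrum.adicCompletion.padicEquiv (R := 𝓞 ℚ) v).toAlgEquiv.toRingEquiv,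
    padicEquiv_algebraMap_rat, padicEquiv_algebraMap_rat]

/-- **`ε_v = ε_p`** for a rational diagonal form at a finite place. [cite: Serre1973, Ch. IV §2.1] -/
theorem hasseProd_adicCompletion_rat_eq {n : ℕ} (c : Fin n → ℚ) :
    hasseProd (hilbertSymbol (v.adicCompletion ℚ)) (fun i => algebraMap ℚ (v.adicCompletion ℚ) (c i)) =
      hasseProd (hilbertSymbol ℚ_[Rat.HeightOneSpectrum.primesEquiv (R := 𝓞 ℚ) v])
        (fun i => (c i : ℚ_[Rat.HeightOneSpectrum.primesEquiv (R := 𝓞 ℚ) v])) := by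
  unfold hasseProd
  refine prod_congr rfl fun i _ => prod_congr rfl fun j _ => ?_
  split_ifs
  · exact hilbertSymbol_adicCompletion_rat_eq v _ _
  · rfl

end Finite

/-! ### The infinite place -/

section Infinite

variable (w : InfinitePlace ℚ)

/-- `ℚ_w ≃ ℝ` (`ringEquivRealOfIsReal`, `ℚ` totally real) sends `algebraMap ℚ ℚ_w q` to `q` (Serre,
Ch. IV §3.1: `ℚ_∞` is `ℝ`). [cite: Serre1973, Ch. IV §3.1] -/
theorem ringEquivReal_algebraMap_rat (q : ℚ) :
    InfinitePlace.Completion.ringEquivRealOfIsReal (IsTotallyReal.isReal w)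
      (algebraMap ℚ w.Completion q) = (q : ℝ) :=
  eq_ratCast ((InfinitePlace.Completion.ringEquivRealOfIsReal
    (IsTotallyReal.isReal w)).toRingHom.comp (algebraMap ℚ w.Completion)) q

/-- **Isotropy at the infinite place of `ℚ`**: `⟨c⟩` represents `0` in `ℚ_w` iff it does in `ℝ`.
[cite: Omeara1963, §66 Thm 66:1] -/
theorem diagIsotropic_infinitePlace_rat_iff {n : ℕ} (c : Fin n → ℚ) :
    DiagIsotropic (fun i => algebraMap ℚ w.Completion (c i)) ↔ DiagIsotropic (fun i => (c i : ℝ)) := by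
  have hfun : (fun i => InfinitePlace.Completion.ringEquivRealOfIsReal (IsTotallyReal.isReal w)
      (algebraMap ℚ w.Completion (c i))) = fun i => (c i : ℝ) :=
    funext fun i => ringEquivReal_algebraMap_rat w (c i)
  constructor
  · intro h
    rw [← hfun]
    exact h.map (InfinitePlace.Completion.ringEquivRealOfIsReal (IsTotallyReal.isReal w)).toRingHom
      (RingEquiv.injective _)
  · intro h
    refine DiagIsotropic.of_ringEquiv
      (InfinitePlace.Completion.ringEquivRealOfIsReal (IsTotallyReal.isReal w)) ?_
    rw [hfun]
    exact h

/-- **Isometry at the infinite place of `ℚ`**: `⟨a⟩ ≅ ⟨b⟩` over `ℚ_w` iff over `ℝ`.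
[cite: Omeara1963, §66 Thm 66:4] -/
theorem diagIsometric_infinitePlace_rat_iff {n : ℕ} (a b : Fin n → ℚ) :
    DiagIsometric (fun i => algebraMap ℚ w.Completion (a i)) (fun i => algebraMap ℚ w.Completion (b i)) ↔
      DiagIsometric (fun i => (a i : ℝ)) (fun i => (b i : ℝ)) := by
  have hfun : ∀ c : Fin n → ℚ,
      (fun i => InfinitePlace.Completion.ringEquivRealOfIsReal (IsTotallyReal.isReal w)
        (algebraMap ℚ w.Completion (c i))) = fun i => (c i : ℝ) :=
    fun c => funext fun i => ringEquivReal_algebraMap_rat w (c i)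
  constructor
  · intro h
    rw [← hfun a, ← hfun b]
    exact h.map (InfinitePlace.Completion.ringEquivRealOfIsReal (IsTotallyReal.isReal w)).toRingHom
  · intro h
    refine DiagIsometric.of_ringEquiv
      (InfinitePlace.Completion.ringEquivRealOfIsReal (IsTotallyReal.isReal w)) ?_
    rw [hfun a, hfun b]
    exact h

/-- **The Hilbert symbol at the infinite place of `ℚ`** is the real Hilbert symbol.
[cite: Serre1973, Ch. III §1.2 Thm. 1] -/
theorem hilbertSymbol_infinitePlace_rat_eq (a b : ℚ) :
    hilbertSymbol w.Completion (algebraMap ℚ _ a) (algebraMap ℚ _ b) = hilbertSymbol ℝ (a : ℝ) (b : ℝ) := by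
  rw [← hilbertSymbol_map_ringEquiv
      (InfinitePlace.Completion.ringEquivRealOfIsReal (IsTotallyReal.isReal w)),
    ringEquivReal_algebraMap_rat, ringEquivReal_algebraMap_rat]

/-- **`ε_w = ε_∞`** for a rational diagonal form at the infinite place. [cite: Serre1973, Ch. IV §2.1] -/
theorem hasseProd_infinitePlace_rat_eq {n : ℕ} (c : Fin n → ℚ) :
    hasseProd (hilbertSymbol w.Completion) (fun i => algebraMap ℚ w.Completion (c i)) =
      hasseProd (hilbertSymbol ℝ) (fun i => (c i : ℝ)) := by
  unfold hasseProd
  refine prod_congr rfl fun i _ => prod_congr rfl fun j _ => ?_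
  split_ifs
  · exact hilbertSymbol_infinitePlace_rat_eq w _ _
  · rfl

end Infinite

/-! ### Application: the anisotropic primes of a rational ternary form -/

/-- **The anisotropic primes of a rational ternary form** (Serre, Ch. IV §3.2 Cor. 3 / Ch. III §2.1
Thm 3, in the `ℚ_[p]` / `ℝ` language; `rat_ternary_anisotropic_places_even` transported along the
dictionary): the primes `p` at which a nondegenerate rational ternary diagonal form does not represent
`0` in `ℚ_p` form a finite set `S`, and `#S` is even iff the form represents `0` over `ℝ` (is indefinite).
[cite: Serre1973, Ch. IV §3.2 Cor. 3 to Thm 8] -/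
theorem rat_ternary_anisotropic_primes {c : Fin 3 → ℚ} (hc : ∀ i, c i ≠ 0) :
    ∃ S : Finset ℕ, (∀ p ∈ S, p.Prime) ∧
      (∀ (p : ℕ) [Fact p.Prime], p ∈ S ↔ ¬ DiagIsotropic (fun i => (c i : ℚ_[p]))) ∧
      (Even S.card ↔ DiagIsotropic (fun i => (c i : ℝ))) := by
  classical
  obtain ⟨hfin, heven⟩ := rat_ternary_anisotropic_places_even hc
  -- the infinite place
  have hinf : {w : InfinitePlace ℚ | ¬ DiagIsotropic (fun i => algebraMap ℚ w.Completion (c i))}.ncard =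
      if DiagIsotropic (fun i => (c i : ℝ)) then 0 else 1 := by
    have hset' : {w : InfinitePlace ℚ | ¬ DiagIsotropic (fun i => algebraMap ℚ w.Completion (c i))} =
        if DiagIsotropic (fun i => (c i : ℝ)) then ∅ else Set.univ := by
      ext w
      simp only [Set.mem_setOf_eq, diagIsotropic_infinitePlace_rat_iff]
      split_ifs with h <;> simp [h]
    rw [hset']
    split_ifs
    · exact Set.ncard_empty _
    · rw [Set.ncard_univ, Nat.card_unique]
  -- the finite set of primes
  refine ⟨hfin.toFinset.image fun v => (Rat.HeightOneSpectrum.primesEquiv (R := 𝓞 ℚ) v : ℕ),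
    fun p hp => ?_, fun p hp => ?_, ?_⟩
  · obtain ⟨v, -, rfl⟩ := Finset.mem_image.mp hp
    exact (Rat.HeightOneSpectrum.primesEquiv (R := 𝓞 ℚ) v).2
  · obtain ⟨v, hv⟩ := (Rat.HeightOneSpectrum.primesEquiv (R := 𝓞 ℚ)).surjective ⟨p, hp.out⟩
    have hvp : (Rat.HeightOneSpectrum.primesEquiv (R := 𝓞 ℚ) v : ℕ) = p := congrArg Subtype.val hv
    subst hvp
    rw [← diagIsotropic_adicCompletion_rat_iff v c, Finset.mem_image]
    constructor
    · rintro ⟨v', hv', h'⟩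
      have hvv : v' = v := (Rat.HeightOneSpectrum.primesEquiv (R := 𝓞 ℚ)).injective (Subtype.ext h')
      subst hvv
      exact (Set.Finite.mem_toFinset hfin).mp hv'
    · intro h
      exact ⟨v, (Set.Finite.mem_toFinset hfin).mpr h, rfl⟩
  · have hinj : Function.Injective fun v : HeightOneSpectrum (𝓞 ℚ) =>
        (Rat.HeightOneSpectrum.primesEquiv (R := 𝓞 ℚ) v : ℕ) := fun v v' h =>
      (Rat.HeightOneSpectrum.primesEquiv (R := 𝓞 ℚ)).injective (Subtype.ext h)
    rw [Finset.card_image_of_injective _ hinj, ← Set.ncard_eq_toFinset_card _ hfin]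
    rw [hinf] at heven
    split_ifs at heven with h
    · simpa [h] using heven
    · simp only [h, iff_false, Nat.not_even_iff_odd]
      exact (Nat.even_add_one.mp heven |> Nat.not_even_iff_odd.mp)

end Literature.NumberTheory.QuadraticForms

end
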